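import Literature.Barriers.CriticalPhenomena.LaceExpansionGaussianLemmaProofs
import HarnessLib

/-!
# `Hara2008_gaussianConvolution` holds (Hara 2008, Cor. 1.4), via Thm. 1.3

Sibling of `LaceExpansionXSpaceAsymptotics.lean`, which vendors Hara's Gaussian lemma in
convolution form as the named fact `Hara2008_gaussianConvolution` (Hara 2008, Cor. 1.4, the
quantitative half: for a signed `ℤ^d`-symmetric kernel `J` and source `g` as in Thm. 1.3/Cor. 1.4,
`H(x) = ∫ e^{ikx} ĝ/(1-Ĵ) dk/(2π)^d = [Σg/Σ|y|²J(y)] a_d |x|^{2-d} + O(|x|^{-(d-2+(ρ∧2)/d)})`, `d ≥ 3`).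
Its printed proof is now formalised end to end in the catalogue, along Hara's own architecture:

* Cor. 1.4 ⇐ Thm. 1.3: `Hara2008_gaussianConvolution_of_thm13` (`LaceExpansionGaussianLemma.lean`;
  "`H(x) = (C*g)(x)`" by Fubini, and the convolution Lemma B.1 (ii));
* Thm. 1.3 ⇐ Lemmas 2.2 + 2.3: `Hara2008_thm13_of_lemmas` (`LaceExpansionGaussianLemmaAssembly.lean`;
  `C = ∫₀^∞ I_t dt`, the split at `T = |x|^{2-(ρ∧2)/d}` of §2.6 and the Gaussian time integrals),
  assembled as `Hara2008_thm13_holds` (`LaceExpansionGaussianLemmaProofs.lean`);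
* Lemma 2.2 (large `t`): `Hara2008_lem22_holds` (`LaceExpansionGaussianLargeT.lean`);
* Lemma 2.3 (small `t`, `d` integrations by parts and Lemma B.1 (iii)): `Hara2008_lem23_holds`
  (`HaraGaussianLemmaSmallTime.lean`, with `HaraGaussianLemmaHeatKernel.lean`,
  `HaraGaussianLemmaTorusIBP.lean`, `HaraGaussianLemmaConvolution.lean`).

This file records the resulting unconditional theorem `Hara2008_gaussianConvolution_holds`
(Cor. 1.4) and its consequence for the catalogue: the reduction
`Hara2008_etaZeroXSpace_of_framework` (`LaceExpansionXSpaceAsymptotics.lean`) now rests on the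
lace-expansion input `Hara2008_laceExpansionPc` alone (`Hara2008_etaZeroXSpace_of_laceExpansionPc`).

## References

* T. Hara, *Decay of correlations in nearest-neighbor self-avoiding walk, percolation, lattice
  trees and animals*, Ann. Probab. 36 (2008) 530–593 (arXiv:math-ph/0504021): Thm. 1.3, Cor. 1.4
  and its one-line proof (§1.2.2), §2 (Lemmas 2.1–2.3, §2.6), Appendix B (Lemma B.1).
* M. Heydenreich, R. van der Hofstad, *Progress in High-Dimensional Percolation and Random Graphs*,
  Springer 2017: Thm. 11.4 and pp. 137–139.
-/

namespace Literature.Barriers.CriticalPhenomena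

/-- **Hara 2008, Cor. 1.4 (quantitative half) is a theorem**: the named fact
`Hara2008_gaussianConvolution` of `LaceExpansionXSpaceAsymptotics.lean` holds ("Corollary 1.4
follows immediately from Theorem 1.3 and a basic property of convolutions, Lemma B.1. This is
because `H(x) = (C*g)(x)`"), by `Hara2008_gaussianConvolution_of_thm13` and the proved Thm. 1.3
`Hara2008_thm13_holds`. [cite: Hara2008, Cor. 1.4 and its proof (§1.2.2), with Thm. 1.3] -/
theorem Hara2008_gaussianConvolution_holds : Hara2008_gaussianConvolution :=
  Hara2008_gaussianConvolution_of_thm13 Hara2008_thm13_holds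

/-- **`Hara2008_etaZeroXSpace` now rests on the lace-expansion input alone**: `η = 0` in `x`-space
for `d ≥ 11` (Heydenreich–van der Hofstad 2017, Thm. 11.4) follows from the named fact
`Hara2008_laceExpansionPc` (Hara 2008, Prop. 1.2 at `p_c` with the bootstrap bound on `Π_{p_c}`),
the Gaussian lemma being proved. [cite: Hara2008, §1.2 (framework of the proof of Thm. 1.1)]
[cite: HeydenreichVanDerHofstad2017, Thm. 11.4 and pp. 137–139] -/
theorem Hara2008_etaZeroXSpace_of_laceExpansionPc (hP : Hara2008_laceExpansionPc) : Hara2008_etaZeroXSpace :=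
  Hara2008_etaZeroXSpace_of_framework Hara2008_gaussianConvolution_holds hP

end Literature.Barriers.CriticalPhenomena
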